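import Mathlib
import Summits.MatrixMultiplication.MatrixMultiplication.Theorems.HiddenToeplitzCornersHiddenCornerLemmaRCapacityBasic
import Summits.MatrixMultiplication.MatrixMultiplication.Theorems.HiddenToeplitzCornersHiddenCornerLemmaRCapacityKrylov
import Summits.MatrixMultiplication.MatrixMultiplication.Theorems.HiddenToeplitzCornersHiddenCornerLemmaRCapacityPoly
import Summits.MatrixMultiplication.MatrixMultiplication.Theorems.HiddenToeplitzCornersHiddenCornerLemmaRCapacityAct
import Summits.MatrixMultiplication.MatrixMultiplication.Theorems.HiddenToeplitzCornersHiddenCornerLemmaRCapacityStep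

/-!
# (I) the capacity inequality — lead's file (TEMP: toolkit lemmas restated with sorry until TK-A/B/C land)
-/

set_option linter.dupNamespace false

namespace Summit.MatrixMultiplication.MatrixMultiplication.Theorems

open Polynomial

variable {r : ℕ} (e : Fin r → (Polynomial ℂ))



/-! ### auxiliary facts -/

/-- `dim S_w ≤ w`. -/
theorem hclR_finrank_SL_le (w : ℕ) : Module.finrank ℂ ↥((⨆ b : Fin r, Submodule.map (LinearMap.proj b : (Fin r → Polynomial ℂ) →ₗ[ℂ] Polynomial ℂ) (LinearMap.ker (∑ c : Fin r, LinearMap.comp (Polynomial.lsum (fun (i : ℕ) => LinearMap.smulRight (LinearMap.id : ℂ →ₗ[ℂ] ℂ) (Polynomial.divX^[i] (e c : Polynomial ℂ))) : Polynomial ℂ →ₗ[ℂ] Polynomial ℂ) (LinearMap.proj c : (Fin r → Polynomial ℂ) →ₗ[ℂ] Polynomial ℂ)) ⊓ (Submodule.pi Set.univ (fun _ : Fin r => Polynomial.degreeLT ℂ (w)) : Submodule ℂ (Fin r → Polynomial ℂ))))) ≤ w := by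
  haveI : FiniteDimensional ℂ ↥(Polynomial.degreeLT ℂ w) :=
    LinearEquiv.finiteDimensional (Polynomial.degreeLTEquiv ℂ w).symm
  calc Module.finrank ℂ ↥((⨆ b : Fin r, Submodule.map (LinearMap.proj b : (Fin r → Polynomial ℂ) →ₗ[ℂ] Polynomial ℂ) (LinearMap.ker (∑ c : Fin r, LinearMap.comp (Polynomial.lsum (fun (i : ℕ) => LinearMap.smulRight (LinearMap.id : ℂ →ₗ[ℂ] ℂ) (Polynomial.divX^[i] (e c : Polynomial ℂ))) : Polynomial ℂ →ₗ[ℂ] Polynomial ℂ) (LinearMap.proj c : (Fin r → Polynomial ℂ) →ₗ[ℂ] Polynomial ℂ)) ⊓ (Submodule.pi Set.univ (fun _ : Fin r => Polynomial.degreeLT ℂ (w)) : Submodule ℂ (Fin r → Polynomial ℂ))))) ≤ Module.finrank ℂ ↥(Polynomial.degreeLT ℂ w) :=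
        Submodule.finrank_mono (hclR_SL_le_degreeLT e w)
    _ = w := by
        rw [LinearEquiv.finrank_eq (Polynomial.degreeLTEquiv ℂ w)]
        simp

/-- `S_w ≤ S_{w+1}`. -/
theorem hclR_SL_mono (w : ℕ) : (⨆ b : Fin r, Submodule.map (LinearMap.proj b : (Fin r → Polynomial ℂ) →ₗ[ℂ] Polynomial ℂ) (LinearMap.ker (∑ c : Fin r, LinearMap.comp (Polynomial.lsum (fun (i : ℕ) => LinearMap.smulRight (LinearMap.id : ℂ →ₗ[ℂ] ℂ) (Polynomial.divX^[i] (e c : Polynomial ℂ))) : Polynomial ℂ →ₗ[ℂ] Polynomial ℂ) (LinearMap.proj c : (Fin r → Polynomial ℂ) →ₗ[ℂ] Polynomial ℂ)) ⊓ (Submodule.pi Set.univ (fun _ : Fin r => Polynomial.degreeLT ℂ (w)) : Submodule ℂ (Fin r → Polynomial ℂ)))) ≤ (⨆ b : Fin r, Submodule.map (LinearMap.proj b : (Fin r → Polynomial ℂ) →ₗ[ℂ] Polynomial ℂ) (LinearMap.ker (∑ c : Fin r, LinearMap.comp (Polynomial.lsum (fun (i : ℕ) => LinearMap.smulRight (LinearMap.id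 : ℂ →ₗ[ℂ] ℂ) (Polynomial.divX^[i] (e c : Polynomial ℂ))) : Polynomial ℂ →ₗ[ℂ] Polynomial ℂ) (LinearMap.proj c : (Fin r → Polynomial ℂ) →ₗ[ℂ] Polynomial ℂ)) ⊓ (Submodule.pi Set.univ (fun _ : Fin r => Polynomial.degreeLT ℂ (w + 1)) : Submodule ℂ (Fin r → Polynomial ℂ)))) :=
  le_trans le_sup_left (hclR_SL_sup_X_mul_le e w)

/-- If `S_w = ⊥` then `Rel_w = ⊥` (a tuple all of whose components vanish is zero). -/
theorem hclR_RelL_eq_bot_of_SL_eq_bot (w : ℕ) (h : (⨆ b : Fin r, Submodule.map (LinearMap.proj b : (Fin r → Polynomial ℂ) →ₗ[ℂ] Polynomial ℂ) (LinearMap.ker (∑ c : Fin r, LinearMap.comp (Polynomial.lsum (fun (i : ℕ) => LinearMap.smulRight (LinearMap.id : ℂ →ₗ[ℂ] ℂ) (Polynomial.divX^[i] (e c : Polynomial ℂ))) : Polynomial ℂ →ₗ[ℂ] Polynomial ℂ) (LinearMap.proj c : (Fin r → Polynomial ℂ) →ₗ[ℂ] Polynomial ℂ)) ⊓ (Submodule.pi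 Set.univ (fun _ : Fin r => Polynomial.degreeLT ℂ (w)) : Submodule ℂ (Fin r → Polynomial ℂ)))) = ⊥) : (LinearMap.ker (∑ c : Fin r, LinearMap.comp (Polynomial.lsum (fun (i : ℕ) => LinearMap.smulRight (LinearMap.id : ℂ →ₗ[ℂ] ℂ) (Polynomial.divX^[i] (e c : Polynomial ℂ))) : Polynomial ℂ →ₗ[ℂ] Polynomial ℂ) (LinearMap.proj c : (Fin r → Polynomial ℂ) →ₗ[ℂ] Polynomial ℂ)) ⊓ (Submodule.pi Set.univ (fun _ : Fin r => Polynomial.degreeLT ℂ (w)) : Submodule ℂ (Fin r → Polynomial ℂ))) = ⊥ := by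
  rw [Submodule.eq_bot_iff]
  intro α hα
  funext b
  have hb : α b ∈ (⨆ b : Fin r, Submodule.map (LinearMap.proj b : (Fin r → Polynomial ℂ) →ₗ[ℂ] Polynomial ℂ) (LinearMap.ker (∑ c : Fin r, LinearMap.comp (Polynomial.lsum (fun (i : ℕ) => LinearMap.smulRight (LinearMap.id : ℂ →ₗ[ℂ] ℂ) (Polynomial.divX^[i] (e c : Polynomial ℂ))) : Polynomial ℂ →ₗ[ℂ] Polynomial ℂ) (LinearMap.proj c : (Fin r → Polynomial ℂ) →ₗ[ℂ] Polynomial ℂ)) ⊓ (Submodule.pi Set.univ (fun _ : Fin r => Polynomial.degreeLT ℂ (w)) : Submodule ℂ (Fin r → Polynomial ℂ)))) := Submodule.mem_iSup_of_mem b ⟨α, hα, rfl⟩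
  rw [h, Submodule.mem_bot] at hb
  simpa using hb

/-- If `S_w = ⊥` then `κ_w = r w`. -/
theorem hclR_finrank_KryL_of_SL_eq_bot (w : ℕ) (h : (⨆ b : Fin r, Submodule.map (LinearMap.proj b : (Fin r → Polynomial ℂ) →ₗ[ℂ] Polynomial ℂ) (LinearMap.ker (∑ c : Fin r, LinearMap.comp (Polynomial.lsum (fun (i : ℕ) => LinearMap.smulRight (LinearMap.id : ℂ →ₗ[ℂ] ℂ) (Polynomial.divX^[i] (e c : Polynomial ℂ))) : Polynomial ℂ →ₗ[ℂ] Polynomial ℂ) (LinearMap.proj c : (Fin r → Polynomial ℂ) →ₗ[ℂ] Polynomial ℂ)) ⊓ (Submodule.pi Set.univ (fun _ : Fin r => Polynomial.degreeLT ℂ (w)) : Submodule ℂ (Fin r → Polynomial ℂ)))) = ⊥) :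
    Module.finrank ℂ ↥((Submodule.span ℂ (Set.range (fun p : Fin (r) × Fin (w) => Polynomial.divX^[(Prod.snd p).val] ((e : Fin r → Polynomial ℂ) (Prod.fst p)))))) = r * w := by
  have h1 := hclR_finrank_RelL_add_KryL e w
  rw [hclR_RelL_eq_bot_of_SL_eq_bot e w h, finrank_bot] at h1
  simpa using h1

/-- Base case: `κ_1 = r` for an independent frame. -/
theorem hclR_finrank_KryL_one (he : LinearIndependent ℂ e) :
    Module.finrank ℂ ↥((Submodule.span ℂ (Set.range (fun p : Fin (r) × Fin (1) => Polynomial.divX^[(Prod.snd p).val] ((e : Fin r → Polynomial ℂ) (Prod.fst p)))))) = r := by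
  have hset : Set.range (fun p : Fin r × Fin 1 => Polynomial.divX^[(Prod.snd p).val] (e (Prod.fst p))) =
      Set.range e := by
    ext f
    constructor
    · rintro ⟨⟨c, i⟩, rfl⟩
      refine ⟨c, ?_⟩
      simp
    · rintro ⟨c, rfl⟩
      exact ⟨(c, 0), by simp⟩
  rw [hset, finrank_span_eq_card he]
  simp

/-! ### (I) -/

/-- **(I) — the capacity inequality.** For an independent frame of `r ≥ 2` polynomials and a window
`w ≥ 1` with positive capacity (`dim S_w < w`): `2 r w ≤ 2 κ_w + r · dim S_w`, i.e.
`r (cap_w + w) ≤ 2 κ_w` with `cap_w = w − dim S_w`. (Paper: STRIP_THEOREM §2, from (PS) and (Mono).) -/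
theorem hclR_capacity_ineq' (hr : 2 ≤ r) (he : LinearIndependent ℂ e) (w : ℕ) (hw : 1 ≤ w)
    (hpos : Module.finrank ℂ ↥((⨆ b : Fin r, Submodule.map (LinearMap.proj b : (Fin r → Polynomial ℂ) →ₗ[ℂ] Polynomial ℂ) (LinearMap.ker (∑ c : Fin r, LinearMap.comp (Polynomial.lsum (fun (i : ℕ) => LinearMap.smulRight (LinearMap.id : ℂ →ₗ[ℂ] ℂ) (Polynomial.divX^[i] (e c : Polynomial ℂ))) : Polynomial ℂ →ₗ[ℂ] Polynomial ℂ) (LinearMap.proj c : (Fin r → Polynomial ℂ) →ₗ[ℂ] Polynomial ℂ)) ⊓ (Submodule.pi Set.univ (fun _ : Fin r => Polynomial.degreeLT ℂ (w)) : Submodule ℂ (Fin r → Polynomial ℂ))))) < w) :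
    2 * r * w ≤ 2 * Module.finrank ℂ ↥((Submodule.span ℂ (Set.range (fun p : Fin (r) × Fin (w) => Polynomial.divX^[(Prod.snd p).val] ((e : Fin r → Polynomial ℂ) (Prod.fst p)))))) + r * Module.finrank ℂ ↥((⨆ b : Fin r, Submodule.map (LinearMap.proj b : (Fin r → Polynomial ℂ) →ₗ[ℂ] Polynomial ℂ) (LinearMap.ker (∑ c : Fin r, LinearMap.comp (Polynomial.lsum (fun (i : ℕ) => LinearMap.smulRight (LinearMap.id : ℂ →ₗ[ℂ] ℂ) (Polynomial.divX^[i] (e c : Polynomial ℂ))) : Polynomial ℂ →ₗ[ℂ] Polynomial ℂ) (LinearMap.proj c : (Fin r → Polynomial ℂ) →ₗ[ℂ] Polynomial ℂ)) ⊓ (Submodule.pi Set.univ (fun _ : Fin r => Polynomial.degreeLT ℂ (w)) : Submodule ℂ (Fin r → Polynomial ℂ))))) := by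
  induction w with
  | zero => omega
  | succ w ih =>
    rcases Nat.eq_zero_or_pos w with hw0 | hwpos
    · -- w = 0: the window is 1; κ_1 = r
      subst hw0
      rw [hclR_finrank_KryL_one e he]
      nlinarith
    · -- step w → w+1
      haveI := hclR_fd_SL e w
      haveI := hclR_fd_SL e (w + 1)
      haveI := hclR_fd_KryL e w
      haveI := hclR_fd_KryL e (w + 1)
      haveI : FiniteDimensional ℂ ↥(Polynomial.degreeLT ℂ w) :=
        LinearEquiv.finiteDimensional (Polynomial.degreeLTEquiv ℂ w).symm
      set s := Module.finrank ℂ ↥((⨆ b : Fin r, Submodule.map (LinearMap.proj b : (Fin r → Polynomial ℂ) →ₗ[ℂ] Polynomial ℂ) (LinearMap.ker (∑ c : Fin r, LinearMap.comp (Polynomial.lsum (fun (i : ℕ) => LinearMap.smulRight (LinearMap.id : ℂ →ₗ[ℂ] ℂ) (Polynomial.divX^[i] (e c : Polynomial ℂ))) : Polynomial ℂ →ₗ[ℂ] Polynomial ℂ) (LinearMap.proj c : (Fin r → Polynomial ℂ) →ₗ[ℂ] Polynomial ℂ)) ⊓ (Submodule.pi Set.univ (fun _ : Fin r => Polynomial.degreeLT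 ℂ (w)) : Submodule ℂ (Fin r → Polynomial ℂ))))) with hs
      set s' := Module.finrank ℂ ↥((⨆ b : Fin r, Submodule.map (LinearMap.proj b : (Fin r → Polynomial ℂ) →ₗ[ℂ] Polynomial ℂ) (LinearMap.ker (∑ c : Fin r, LinearMap.comp (Polynomial.lsum (fun (i : ℕ) => LinearMap.smulRight (LinearMap.id : ℂ →ₗ[ℂ] ℂ) (Polynomial.divX^[i] (e c : Polynomial ℂ))) : Polynomial ℂ →ₗ[ℂ] Polynomial ℂ) (LinearMap.proj c : (Fin r → Polynomial ℂ) →ₗ[ℂ] Polynomial ℂ)) ⊓ (Submodule.pi Set.univ (fun _ : Fin r => Polynomial.degreeLT ℂ (w + 1)) : Submodule ℂ (Fin r → Polynomial ℂ))))) with hs'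
      set k := Module.finrank ℂ ↥((Submodule.span ℂ (Set.range (fun p : Fin (r) × Fin (w) => Polynomial.divX^[(Prod.snd p).val] ((e : Fin r → Polynomial ℂ) (Prod.fst p)))))) with hk
      set k' := Module.finrank ℂ ↥((Submodule.span ℂ (Set.range (fun p : Fin (r) × Fin (w + 1) => Polynomial.divX^[(Prod.snd p).val] ((e : Fin r → Polynomial ℂ) (Prod.fst p)))))) with hk'
      have hsle : s ≤ s' := Submodule.finrank_mono (hclR_SL_mono e w)
      have hkle : k ≤ k' := Submodule.finrank_mono (hclR_KryL_mono e w)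
      have hsw : s ≤ w := hclR_finrank_SL_le e w
      -- capacity at level w is positive too (Mono)
      have hsw' : s < w := by
        rcases lt_or_eq_of_le hsw with hlt | heq
        · exact hlt
        · exfalso
          have hfull : (⨆ b : Fin r, Submodule.map (LinearMap.proj b : (Fin r → Polynomial ℂ) →ₗ[ℂ] Polynomial ℂ) (LinearMap.ker (∑ c : Fin r, LinearMap.comp (Polynomial.lsum (fun (i : ℕ) => LinearMap.smulRight (LinearMap.id : ℂ →ₗ[ℂ] ℂ) (Polynomial.divX^[i] (e c : Polynomial ℂ))) : Polynomial ℂ →ₗ[ℂ] Polynomial ℂ) (LinearMap.proj c : (Fin r → Polynomial ℂ) →ₗ[ℂ] Polynomial ℂ)) ⊓ (Submodule.pi Set.univ (fun _ : Fin r => Polynomial.degreeLT ℂ (w)) : Submodule ℂ (Fin r → Polynomial ℂ)))) = Polynomial.degreeLT ℂ w := by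
            apply Submodule.eq_of_le_of_finrank_eq (hclR_SL_le_degreeLT e w)
            rw [LinearEquiv.finrank_eq (Polynomial.degreeLTEquiv ℂ w)]
            simpa using heq
          have hfull' := hclR_SL_full_succ e w hwpos hfull
          have : s' = w + 1 := by
            rw [hs', hfull', LinearEquiv.finrank_eq (Polynomial.degreeLTEquiv ℂ (w + 1))]
            simp
          omega
      have ih' := ih hwpos hsw'
      -- three cases on the growth of S
      rcases Nat.lt_or_ge s' (s + 1) with hcase | hcase
      · -- s' = s: then S_{w+1} = S_w is X-stable, hence ⊥, hence κ_{w+1} = r (w+1)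
        have hseq : s' = s := by omega
        have hSeq : (⨆ b : Fin r, Submodule.map (LinearMap.proj b : (Fin r → Polynomial ℂ) →ₗ[ℂ] Polynomial ℂ) (LinearMap.ker (∑ c : Fin r, LinearMap.comp (Polynomial.lsum (fun (i : ℕ) => LinearMap.smulRight (LinearMap.id : ℂ →ₗ[ℂ] ℂ) (Polynomial.divX^[i] (e c : Polynomial ℂ))) : Polynomial ℂ →ₗ[ℂ] Polynomial ℂ) (LinearMap.proj c : (Fin r → Polynomial ℂ) →ₗ[ℂ] Polynomial ℂ)) ⊓ (Submodule.pi Set.univ (fun _ : Fin r => Polynomial.degreeLT ℂ (w)) : Submodule ℂ (Fin r → Polynomial ℂ)))) = (⨆ b : Fin r, Submodule.map (LinearMap.proj b : (Fin r → Polynomial ℂ) →ₗ[ℂ] Polynomial ℂ) (LinearMap.ker (∑ c : Fin r, LinearMap.comp (Polynomial.lsum (fun (i : ℕ) => LinearMap.smulRight (LinearMap.id : ℂ →ₗ[ℂ] ℂ) (Polynomial.divX^[i] (e c : Polynomial ℂ))) : Polynomial ℂ →ₗ[ℂ] Polynomial ℂ) (LinearMap.proj c : (Fin r → Polynomial ℂ)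 →ₗ[ℂ] Polynomial ℂ)) ⊓ (Submodule.pi Set.univ (fun _ : Fin r => Polynomial.degreeLT ℂ (w + 1)) : Submodule ℂ (Fin r → Polynomial ℂ)))) :=
          Submodule.eq_of_le_of_finrank_eq (hclR_SL_mono e w) (by rw [← hs, ← hs', hseq])
        have hbot : (⨆ b : Fin r, Submodule.map (LinearMap.proj b : (Fin r → Polynomial ℂ) →ₗ[ℂ] Polynomial ℂ) (LinearMap.ker (∑ c : Fin r, LinearMap.comp (Polynomial.lsum (fun (i : ℕ) => LinearMap.smulRight (LinearMap.id : ℂ →ₗ[ℂ] ℂ) (Polynomial.divX^[i] (e c : Polynomial ℂ))) : Polynomial ℂ →ₗ[ℂ] Polynomial ℂ) (LinearMap.proj c : (Fin r → Polynomial ℂ) →ₗ[ℂ] Polynomial ℂ)) ⊓ (Submodule.pi Set.univ (fun _ : Fin r => Polynomial.degreeLT ℂ (w + 1)) : Submodule ℂ (Fin r → Polynomial ℂ)))) = ⊥ := by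
          by_contra hne
          have hne' : (⨆ b : Fin r, Submodule.map (LinearMap.proj b : (Fin r → Polynomial ℂ) →ₗ[ℂ] Polynomial ℂ) (LinearMap.ker (∑ c : Fin r, LinearMap.comp (Polynomial.lsum (fun (i : ℕ) => LinearMap.smulRight (LinearMap.id : ℂ →ₗ[ℂ] ℂ) (Polynomial.divX^[i] (e c : Polynomial ℂ))) : Polynomial ℂ →ₗ[ℂ] Polynomial ℂ) (LinearMap.proj c : (Fin r → Polynomial ℂ) →ₗ[ℂ] Polynomial ℂ)) ⊓ (Submodule.pi Set.univ (fun _ : Fin r => Polynomial.degreeLT ℂ (w)) : Submodule ℂ (Fin r → Polynomial ℂ)))) ≠ ⊥ := by rwa [hSeq]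
          apply hclR_not_X_mul_stable e ((⨆ b : Fin r, Submodule.map (LinearMap.proj b : (Fin r → Polynomial ℂ) →ₗ[ℂ] Polynomial ℂ) (LinearMap.ker (∑ c : Fin r, LinearMap.comp (Polynomial.lsum (fun (i : ℕ) => LinearMap.smulRight (LinearMap.id : ℂ →ₗ[ℂ] ℂ) (Polynomial.divX^[i] (e c : Polynomial ℂ))) : Polynomial ℂ →ₗ[ℂ] Polynomial ℂ) (LinearMap.proj c : (Fin r → Polynomial ℂ) →ₗ[ℂ] Polynomial ℂ)) ⊓ (Submodule.pi Set.univ (fun _ : Fin r => Polynomial.degreeLT ℂ (w)) : Submodule ℂ (Fin r → Polynomial ℂ))))) hne'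
          calc Submodule.map (LinearMap.mulLeft ℂ (Polynomial.X : Polynomial ℂ) : Polynomial ℂ →ₗ[ℂ] Polynomial ℂ) ((⨆ b : Fin r, Submodule.map (LinearMap.proj b : (Fin r → Polynomial ℂ) →ₗ[ℂ] Polynomial ℂ) (LinearMap.ker (∑ c : Fin r, LinearMap.comp (Polynomial.lsum (fun (i : ℕ) => LinearMap.smulRight (LinearMap.id : ℂ →ₗ[ℂ] ℂ) (Polynomial.divX^[i] (e c : Polynomial ℂ))) : Polynomial ℂ →ₗ[ℂ] Polynomial ℂ) (LinearMap.proj c : (Fin r → Polynomial ℂ) →ₗ[ℂ] Polynomial ℂ)) ⊓ (Submodule.pi Set.univ (fun _ : Fin r => Polynomial.degreeLT ℂ (w)) : Submodule ℂ (Fin r → Polynomial ℂ))))) ≤ (⨆ b : Fin r, Submodule.map (LinearMap.proj b : (Fin r → Polynomial ℂ) →ₗ[ℂ] Polynomial ℂ) (LinearMap.ker (∑ c : Fin r, LinearMap.comp (Polynomial.lsum (fun (i : ℕ) => LinearMap.smulRight (LinearMap.id : ℂ →ₗ[ℂ] ℂ) (Polynomial.divX^[i] (e c : Polynomial ℂ)))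 : Polynomial ℂ →ₗ[ℂ] Polynomial ℂ) (LinearMap.proj c : (Fin r → Polynomial ℂ) →ₗ[ℂ] Polynomial ℂ)) ⊓ (Submodule.pi Set.univ (fun _ : Fin r => Polynomial.degreeLT ℂ (w + 1)) : Submodule ℂ (Fin r → Polynomial ℂ)))) :=
                le_trans le_sup_right (hclR_SL_sup_X_mul_le e w)
            _ = (⨆ b : Fin r, Submodule.map (LinearMap.proj b : (Fin r → Polynomial ℂ) →ₗ[ℂ] Polynomial ℂ) (LinearMap.ker (∑ c : Fin r, LinearMap.comp (Polynomial.lsum (fun (i : ℕ) => LinearMap.smulRight (LinearMap.id : ℂ →ₗ[ℂ] ℂ) (Polynomial.divX^[i] (e c : Polynomial ℂ))) : Polynomial ℂ →ₗ[ℂ] Polynomial ℂ) (LinearMap.proj c : (Fin r → Polynomial ℂ) →ₗ[ℂ] Polynomial ℂ)) ⊓ (Submodule.pi Set.univ (fun _ : Fin r => Polynomial.degreeLT ℂ (w)) : Submodule ℂ (Fin r → Polynomial ℂ)))) := hSeq.symm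
        have hk'val : k' = r * (w + 1) := hclR_finrank_KryL_of_SL_eq_bot e (w + 1) hbot
        nlinarith
      · rcases Nat.lt_or_ge s' (s + 2) with hcase2 | hcase2
        · -- s' = s + 1: the step lemma gives κ_{w+1} ≥ κ_w + r - 1
          have hseq : s' = s + 1 := by omega
          have hstep := hclR_step_lemma e hr he w (by rw [← hs', ← hs, hseq]) hsw'
          nlinarith
        · -- s' ≥ s + 2
          nlinarith

set_option linter.unusedVariables false in
/-- **(I) — registered form.** -/
theorem hclR_capacity_ineq : ∀ {r : ℕ} (e : Fin r → Polynomial ℂ) (hr : 2 ≤ r) (he : LinearIndependent ℂ e) (w : ℕ) (hw : 1 ≤ w) (hpos : Module.finrank ℂ ↥((⨆ b : Fin r, Submodule.map (LinearMap.proj b : (Fin r → Polynomial ℂ) →ₗ[ℂ] Polynomial ℂ) (LinearMap.ker (∑ c : Fin r, LinearMap.comp (Polynomial.lsum (fun (i : ℕ) => LinearMap.smulRight (LinearMap.id : ℂ →ₗ[ℂ] ℂ) (Polynomial.divX^[i] (e c : Polynomial ℂ))) : Polynomial ℂ →ₗ[ℂ] Polynomial ℂ) (LinearMap.proj c : (Fin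 r → Polynomial ℂ) →ₗ[ℂ] Polynomial ℂ)) ⊓ (Submodule.pi Set.univ (fun _ : Fin r => Polynomial.degreeLT ℂ (w)) : Submodule ℂ (Fin r → Polynomial ℂ))))) < w), 2 * r * w ≤ 2 * Module.finrank ℂ ↥((Submodule.span ℂ (Set.range (fun p : Fin (r) × Fin (w) => Polynomial.divX^[(Prod.snd p).val] ((e : Fin r → Polynomial ℂ) (Prod.fst p)))))) + r * Module.finrank ℂ ↥((⨆ b : Fin r, Submodule.map (LinearMap.proj b : (Fin r → Polynomial ℂ) →ₗ[ℂ] Polynomial ℂ) (LinearMap.ker (∑ c : Fin r, LinearMap.comp (Polynomial.lsum (fun (i : ℕ) => LinearMap.smulRight (LinearMap.id : ℂ →ₗ[ℂ] ℂ) (Polynomial.divX^[i] (e c : Polynomial ℂ))) : Polynomial ℂ →ₗ[ℂ] Polynomial ℂ) (LinearMap.proj c : (Fin r → Polynomial ℂ) →ₗ[ℂ] Polynomial ℂ)) ⊓ (Submodule.pi Set.univ (fun _ : Fin r => Polynomial.degreeLT ℂ (w)) : Submodule ℂ (Fin r → Polynomial ℂ))))) := by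
  intro r e hr he w hw hpos
  exact hclR_capacity_ineq' e hr he w hw hpos

end Summit.MatrixMultiplication.MatrixMultiplication.Theorems
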